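import Summits.ABC.FunctionField.TransferSheetBMY
import Literature.NumberTheory.EllipticCurves.SzpiroOfAbcProofs
import HarnessLib

/-!
# Cell abc-ff — transfer sheet: the fixed-exponent Oesterlé–Silverman elimination (the `6/5` window)
`POLY-ABC(1+ε) ⟹ POLY-SZPIRO(6(1+ε)/(1−5ε))`, typed and proved (kernel), for `0 < ε < 1/5`, i.e.
`POLY-ABC(M) ⟹ POLY-SZPIRO(6M/(6−5M))` on the whole window `1 < M < 6/5`.

`Summits/ABC/FunctionField/TransferSheetSixFifths.lean`, namespace `Summit.ABC.FunctionField` — theorems only.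
AUTHORSHIP: this is the cell abc-ff referee REF-B's certified drop-zone file `pub/abc-ff/ref-2/RefB_SixFifths.lean`
(sha16 `1da4f2ba6c01246d`), written by **abc-ff ref-2 (refuter-abc-ff-ref-2-g0-0)**, landed VERBATIM under the
two cells' ONE-LANDING RULE (abc-ff-plan 2026-08-27T18:05:45Z, abc-an-plan 18:06:04Z) by abc-an pr-2; the only
edits are this paragraph, the namespace (`….FunctionField.RefB` ↦ `….FunctionField`) and the removal of two trailing
`#print axioms` checks (the gate records axioms). Downstream: abc-an's `Summits/ABC/Analytic/Currency.lean` composes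
`polySzpiroWith_of_abcWithExponent` with `Summit.ABC.Analytic.polySzpiroRat_iff_exists_polySzpiroWith` (E21♯:
«abc with exponent `Λ`, `1 ≤ Λ < 6/5` ⟹ rung A-PS `Summit.ABC.PolySzpiroRat`»).

The tree has `abc ⟹ Szpiro` only at the ENVELOPE (`szpiro_of_abcLe_holds`, which chooses `ε`
inside its proof). The cell's bookkeeping («POLY-ABC(M) ⟹ POLY-SZPIRO only for M < 6/5», SHEET
`PolyAbcWith` docstring; census c-4; lens-5 CF-7b PATH «e ≥ 19 ⇒ A-PS») uses the FIXED-exponent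
form, which was a paper chain. This file types it over the tree decls
`Summit.ABC.FunctionField.PolyAbcWith` / `PolySzpiroWith`, re-using the arithmetic core
`SzpiroOfAbc.core_main` (Silverman AEC VIII.11.5(b) + Ex. 8.21): the tree states `real_step` /
`core_main` with the convenience range `ε ≤ 1/41`; they are re-proved below VERBATIM with the natural
range `ε < 1/5` (`real_step'`, `core_main'` — the bound `ε ≤ 1/41` was used only for `0 < 1 − 5ε`). No abc claim; A-PS is NOT abc — POLY-SZPIRO(E); POLY-ABC(M) is NOT abc.
-/

namespace Summit.ABC.FunctionField

open WeierstrassCurve IsDedekindDomain UniqueFactorizationMonoid Finset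
  Literature.NumberTheory.EllipticCurves Literature.NumberTheory.EllipticCurves.SzpiroOfAbc
  Literature.NumberTheory.DiophantineGeometry

/-! ### Verbatim re-proofs of the tree's `real_step` / `core_main` with the range `ε < 1/5` -/

/-- Solving `M ≤ 432 · 6^ε K · M^{5(1+ε)/6} · N^{1+ε}` for `M`: if `M ≤ G K T^{1+ε}`,
`T ≤ 6 P R`, `G ≤ 72 B R₂`, `(B P)⁶ ≤ M⁵` and `R R₂ ≤ N`, then
`M ≤ (432 · 6^ε K)^{6/(1−5ε)} · N^{6(1+ε)/(1−5ε)}`. This is Silverman's manipulation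
"`|Δ|^{1−5ε} ≤ κ_ε^6 N_E^{6+6ε}`" (AEC PDF p. 224) in the form needed here.
[cite: SilvermanAEC2009, VIII.11.5(b), PDF p. 224] -/
theorem real_step' {ε K : ℝ} (hε : 0 < ε) (hε' : ε < 1 / 5) (hK : 0 < K)
    {M G T P R B R₂ N : ℕ} (hM1 : 1 ≤ M) (hB : 1 ≤ B) (hR₂ : 1 ≤ R₂) (hP : 1 ≤ P) (hN : 1 ≤ N)
    (hM : (M : ℝ) ≤ G * K * (T : ℝ) ^ (1 + ε))
    (hT : T ≤ 6 * P * R) (hG : G ≤ 72 * B * R₂) (hQ : (B * P) ^ 6 ≤ M ^ 5) (hL : R * R₂ ≤ N) :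
    (M : ℝ) ≤ (432 * (6 : ℝ) ^ ε * K) ^ (6 / (1 - 5 * ε)) *
      (N : ℝ) ^ (6 * (1 + ε) / (1 - 5 * ε)) := by
  have hε1 : 0 ≤ 1 + ε := by linarith
  have hθ : 0 < 1 - 5 * ε := by linarith
  -- `T^(1+ε) ≤ 6^(1+ε) P^(1+ε) R^(1+ε)`
  have hT' : (T : ℝ) ^ (1 + ε) ≤ (6 : ℝ) ^ (1 + ε) * (P : ℝ) ^ (1 + ε) * (R : ℝ) ^ (1 + ε) := by
    have h1 : (T : ℝ) ≤ 6 * P * R := by exact_mod_cast hT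
    calc (T : ℝ) ^ (1 + ε) ≤ ((6 : ℝ) * P * R) ^ (1 + ε) :=
          Real.rpow_le_rpow (by positivity) h1 hε1
      _ = _ := by
          rw [Real.mul_rpow (by positivity) (by positivity),
            Real.mul_rpow (by positivity) (by positivity)]
  -- `G ≤ 72 B^(1+ε) R₂^(1+ε)`
  have hG' : (G : ℝ) ≤ 72 * (B : ℝ) ^ (1 + ε) * (R₂ : ℝ) ^ (1 + ε) := by
    have h1 : (G : ℝ) ≤ 72 * B * R₂ := by exact_mod_cast hG
    have hB1 : (B : ℝ) ≤ (B : ℝ) ^ (1 + ε) :=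
      Real.self_le_rpow_of_one_le (by exact_mod_cast hB) (by linarith)
    have hR1 : (R₂ : ℝ) ≤ (R₂ : ℝ) ^ (1 + ε) :=
      Real.self_le_rpow_of_one_le (by exact_mod_cast hR₂) (by linarith)
    calc (G : ℝ) ≤ 72 * B * R₂ := h1
      _ ≤ 72 * (B : ℝ) ^ (1 + ε) * (R₂ : ℝ) ^ (1 + ε) := by gcongr
  -- `(B P)^(1+ε) ≤ M^(5(1+ε)/6)` and `(R R₂)^(1+ε) ≤ N^(1+ε)`
  have hBP : (B : ℝ) ^ (1 + ε) * (P : ℝ) ^ (1 + ε) ≤ (M : ℝ) ^ (5 * (1 + ε) / 6) := by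
    have h1 : ((B * P : ℕ) : ℝ) ^ (6 : ℕ) ≤ ((M : ℝ)) ^ (5 : ℕ) := by exact_mod_cast hQ
    have h2 : ((B * P : ℕ) : ℝ) ≤ (M : ℝ) ^ ((5 : ℝ) / 6) := by
      have h3 : ((B * P : ℕ) : ℝ) = ((((B * P : ℕ) : ℝ)) ^ (6 : ℕ)) ^ ((1 : ℝ) / 6) := by
        rw [← Real.rpow_natCast, ← Real.rpow_mul (by positivity)]
        norm_num
      rw [h3]
      calc ((((B * P : ℕ) : ℝ)) ^ (6 : ℕ)) ^ ((1 : ℝ) / 6)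
          ≤ (((M : ℝ)) ^ (5 : ℕ)) ^ ((1 : ℝ) / 6) :=
            Real.rpow_le_rpow (by positivity) h1 (by norm_num)
        _ = (M : ℝ) ^ ((5 : ℝ) / 6) := by
            rw [← Real.rpow_natCast, ← Real.rpow_mul (by positivity)]
            norm_num
    calc (B : ℝ) ^ (1 + ε) * (P : ℝ) ^ (1 + ε) = ((B * P : ℕ) : ℝ) ^ (1 + ε) := by
          push_cast
          rw [Real.mul_rpow (by positivity) (by positivity)]
      _ ≤ ((M : ℝ) ^ ((5 : ℝ) / 6)) ^ (1 + ε) := Real.rpow_le_rpow (by positivity) h2 hε1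
      _ = (M : ℝ) ^ (5 * (1 + ε) / 6) := by
          rw [← Real.rpow_mul (by positivity)]
          ring_nf
  have hRR : (R : ℝ) ^ (1 + ε) * (R₂ : ℝ) ^ (1 + ε) ≤ (N : ℝ) ^ (1 + ε) := by
    have h1 : ((R * R₂ : ℕ) : ℝ) ≤ N := by exact_mod_cast hL
    calc (R : ℝ) ^ (1 + ε) * (R₂ : ℝ) ^ (1 + ε) = ((R * R₂ : ℕ) : ℝ) ^ (1 + ε) := by
          push_cast
          rw [Real.mul_rpow (by positivity) (by positivity)]
      _ ≤ (N : ℝ) ^ (1 + ε) := Real.rpow_le_rpow (by positivity) h1 hε1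
  -- combine: `M ≤ A · M^(5(1+ε)/6) · N^(1+ε)` with `A = 432 · 6^ε · K`
  set A : ℝ := 432 * (6 : ℝ) ^ ε * K with hA
  have hApos : 0 < A := by positivity
  have h6 : (6 : ℝ) ^ (1 + ε) = 6 * (6 : ℝ) ^ ε := by
    rw [Real.rpow_add (by norm_num), Real.rpow_one]
  have hmain : (M : ℝ) ≤ A * (M : ℝ) ^ (5 * (1 + ε) / 6) * (N : ℝ) ^ (1 + ε) := by
    calc (M : ℝ) ≤ G * K * (T : ℝ) ^ (1 + ε) := hM
      _ ≤ (72 * (B : ℝ) ^ (1 + ε) * (R₂ : ℝ) ^ (1 + ε)) * K *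
            ((6 : ℝ) ^ (1 + ε) * (P : ℝ) ^ (1 + ε) * (R : ℝ) ^ (1 + ε)) := by gcongr
      _ = 72 * (6 : ℝ) ^ (1 + ε) * K * ((B : ℝ) ^ (1 + ε) * (P : ℝ) ^ (1 + ε)) *
            ((R : ℝ) ^ (1 + ε) * (R₂ : ℝ) ^ (1 + ε)) := by ring
      _ ≤ 72 * (6 : ℝ) ^ (1 + ε) * K * (M : ℝ) ^ (5 * (1 + ε) / 6) * (N : ℝ) ^ (1 + ε) := by
          gcongr
      _ = A * (M : ℝ) ^ (5 * (1 + ε) / 6) * (N : ℝ) ^ (1 + ε) := by rw [hA, h6]; ring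
  -- divide by `M^(5(1+ε)/6)` and take the `1/θ`-th power, `θ = (1 - 5ε)/6`
  have hMpos : (0 : ℝ) < M := by exact_mod_cast hM1
  set θ : ℝ := (1 - 5 * ε) / 6 with hθdef
  have hθpos : 0 < θ := by positivity
  have hsplit : (M : ℝ) = (M : ℝ) ^ θ * (M : ℝ) ^ (5 * (1 + ε) / 6) := by
    rw [← Real.rpow_add hMpos]
    have : θ + 5 * (1 + ε) / 6 = 1 := by rw [hθdef]; ring
    rw [this, Real.rpow_one]
  have hθle : (M : ℝ) ^ θ ≤ A * (N : ℝ) ^ (1 + ε) := by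
    have hpow : 0 < (M : ℝ) ^ (5 * (1 + ε) / 6) := Real.rpow_pos_of_pos hMpos _
    rw [hsplit] at hmain
    have : (M : ℝ) ^ θ * (M : ℝ) ^ (5 * (1 + ε) / 6) ≤
        (A * (N : ℝ) ^ (1 + ε)) * (M : ℝ) ^ (5 * (1 + ε) / 6) := by
      calc _ ≤ A * ((M : ℝ) ^ θ * (M : ℝ) ^ (5 * (1 + ε) / 6)) ^ (5 * (1 + ε) / 6) *
            (N : ℝ) ^ (1 + ε) := hmain
        _ = _ := by rw [← hsplit]; ring
    exact le_of_mul_le_mul_right this hpow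
  have hfinal : (M : ℝ) ≤ (A * (N : ℝ) ^ (1 + ε)) ^ (1 / θ) := by
    have h1 : (M : ℝ) = ((M : ℝ) ^ θ) ^ (1 / θ) := by
      rw [← Real.rpow_mul hMpos.le, mul_one_div_cancel hθpos.ne', Real.rpow_one]
    rw [h1]
    exact Real.rpow_le_rpow (by positivity) hθle (by positivity)
  calc (M : ℝ) ≤ (A * (N : ℝ) ^ (1 + ε)) ^ (1 / θ) := hfinal
    _ = A ^ (1 / θ) * ((N : ℝ) ^ (1 + ε)) ^ (1 / θ) := Real.mul_rpow hApos.le (by positivity)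
    _ = A ^ (6 / (1 - 5 * ε)) * (N : ℝ) ^ (6 * (1 + ε) / (1 - 5 * ε)) := by
        rw [← Real.rpow_mul (by positivity)]
        congr 1
        · congr 1; rw [hθdef]; field_simp
        · congr 1; rw [hθdef]; field_simp

/-- **Main case `c₄ c₆ ≠ 0`** of the arithmetic core (Silverman AEC VIII.11.5(b) with Ex. 8.21), on
natural numbers `m = |c₄|`, `n = |c₆|`, `d = |Δ|`: abc applied to the triple divided by
`G = gcd(m³, n²)` (`abc_max_le`), the estimates `radical_le`, `gcd_le`, `radical_mul_prod_dvd`, and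
`real_step` give `d ≤ max(m³, n²) ≤ (432 · 6^ε K)^{6/(1−5ε)} · N^{6(1+ε)/(1−5ε)}`.
[cite: SilvermanAEC2009, VIII.11.5(b) and Ex. 8.21] -/
theorem core_main' {ε K : ℝ} (hε : 0 < ε) (hε' : ε < 1 / 5)
    (hK : ∀ a b c : ℕ, IsABCTriple a b c → (c : ℝ) ≤ K * ((rad a b c : ℕ) : ℝ) ^ (1 + ε))
    {m n d N : ℕ} (hm : m ≠ 0) (hn : n ≠ 0) (hd : d ≠ 0) (hN : N ≠ 0)
    (hrel : m ^ 3 + n ^ 2 = 1728 * d ∨ m ^ 3 + 1728 * d = n ^ 2 ∨ n ^ 2 + 1728 * d = m ^ 3)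
    (H1 : ∀ p, p.Prime → p ∣ d → p ∣ N)
    (H2 : ∀ p, p.Prime → 5 ≤ p → p ∣ d → p ∣ m → p ^ 2 ∣ N)
    (H3 : ∀ p, p.Prime → 5 ≤ p → p ^ 4 ∣ m → ¬ p ^ 6 ∣ n)
    (H4 : 2 ^ 8 ∣ m → ¬ 2 ^ 11 ∣ n) (H5 : 3 ^ 5 ∣ m → ¬ 3 ^ 9 ∣ n) :
    (d : ℝ) ≤ (432 * (6 : ℝ) ^ ε * K) ^ (6 / (1 - 5 * ε)) *
      (N : ℝ) ^ (6 * (1 + ε) / (1 - 5 * ε)) := by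
  have hKpos : 0 < K := abc_const_pos hK
  set s := (6 * d).primeFactors with hs
  have hX : 0 < m ^ 3 := by positivity
  have hY : 0 < n ^ 2 := by positivity
  have hZ : 0 < 1728 * d := by positivity
  -- a prime dividing `m` and `n` divides `1728 d`
  have hcommon : ∀ p, p.Prime → p ∣ m → p ∣ n → p ∈ s := by
    intro p hp hpm hpn
    have hpX : p ∣ m ^ 3 := hpm.trans (dvd_pow_self m three_ne_zero)
    have hpY : p ∣ n ^ 2 := hpn.trans (dvd_pow_self n two_ne_zero)
    have hpZ : p ∣ 1728 * d := by
      rcases hrel with h | h | h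
      · rw [← h]; exact dvd_add hpX hpY
      · exact (Nat.dvd_add_right hpX).mp (h ▸ hpY)
      · exact (Nat.dvd_add_right hpY).mp (h ▸ hpX)
    exact mem_primeFactors_of_dvd_1728_mul hp hd hpZ
  have habc := abc_max_le hε hK hX hY hZ hrel
  -- the data of `real_step`
  set Bm := ∏ p ∈ m.primeFactors ∩ s, p ^ m.factorization p with hBm
  set Bn := ∏ p ∈ n.primeFactors ∩ s, p ^ n.factorization p with hBn
  set Gm := ∏ p ∈ m.primeFactors \ s, p ^ m.factorization p with hGm
  set Gn := ∏ p ∈ n.primeFactors \ s, p ^ n.factorization p with hGn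
  set P := ∏ p ∈ (m * n).primeFactors \ s, p with hP
  set R₂ := ∏ p ∈ d.primeFactors with (5 ≤ p ∧ p ∣ m), p with hR₂
  have hBm0 : 0 < Bm := Finset.prod_pos fun p hp ↦
    pow_pos (Nat.prime_of_mem_primeFactors (Finset.mem_inter.mp hp).1).pos _
  have hBn0 : 0 < Bn := Finset.prod_pos fun p hp ↦
    pow_pos (Nat.prime_of_mem_primeFactors (Finset.mem_inter.mp hp).1).pos _
  have hGm0 : 0 < Gm := Finset.prod_pos fun p hp ↦
    pow_pos (Nat.prime_of_mem_primeFactors (Finset.mem_sdiff.mp hp).1).pos _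
  have hGn0 : 0 < Gn := Finset.prod_pos fun p hp ↦
    pow_pos (Nat.prime_of_mem_primeFactors (Finset.mem_sdiff.mp hp).1).pos _
  have hP0 : 0 < P := Finset.prod_pos fun p hp ↦
    (Nat.prime_of_mem_primeFactors (Finset.mem_sdiff.mp hp).1).pos
  have hR₂0 : 0 < R₂ := Finset.prod_pos fun p hp ↦
    (Nat.prime_of_mem_primeFactors (Finset.mem_filter.mp hp).1).pos
  have hmeq : Gm * Bm = m := prod_sdiff_mul_prod_inter_factorization hm s
  have hneq : Gn * Bn = n := prod_sdiff_mul_prod_inter_factorization hn s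
  have hT : radical (m ^ 3 * n ^ 2 * (1728 * d)) ≤ 6 * P * radical d := radical_le hm hn hd
  have hG : Nat.gcd (m ^ 3) (n ^ 2) ≤ 72 * (Bm * Bn) * R₂ := by
    have := gcd_le hm hn hd hcommon H3 H4 H5
    simpa only [mul_assoc] using this
  have hQ : (Bm * Bn * P) ^ 6 ≤ (max (m ^ 3) (n ^ 2)) ^ 5 := by
    have hPle : P ≤ Gm * Gn :=
      Nat.le_of_dvd (Nat.mul_pos hGm0 hGn0) (prod_primeFactors_sdiff_dvd hm hn s)
    have h1 : Bm * Bn * P ≤ m * n := by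
      calc Bm * Bn * P ≤ Bm * Bn * (Gm * Gn) := Nat.mul_le_mul_left _ hPle
        _ = (Gm * Bm) * (Gn * Bn) := by ring
        _ = m * n := by rw [hmeq, hneq]
    calc (Bm * Bn * P) ^ 6 ≤ (m * n) ^ 6 := Nat.pow_le_pow_left h1 6
      _ = (m ^ 3) ^ 2 * (n ^ 2) ^ 3 := by ring
      _ ≤ (max (m ^ 3) (n ^ 2)) ^ 2 * (max (m ^ 3) (n ^ 2)) ^ 3 :=
          Nat.mul_le_mul (Nat.pow_le_pow_left (le_max_left _ _) 2)
            (Nat.pow_le_pow_left (le_max_right _ _) 3)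
      _ = (max (m ^ 3) (n ^ 2)) ^ 5 := by ring
  have hL : radical d * R₂ ≤ N :=
    Nat.le_of_dvd (Nat.pos_of_ne_zero hN) (radical_mul_prod_dvd H1 H2)
  have hmain := real_step' hε hε' hKpos (M := max (m ^ 3) (n ^ 2)) (le_max_of_le_left hX)
    (Nat.mul_pos hBm0 hBn0) hR₂0 hP0 (Nat.pos_of_ne_zero hN) habc hT hG hQ hL
  -- `d ≤ max(m³, n²)`
  have hdle : d ≤ max (m ^ 3) (n ^ 2) := by
    rcases hrel with h | h | h <;> omega
  calc (d : ℝ) ≤ ((max (m ^ 3) (n ^ 2) : ℕ) : ℝ) := by exact_mod_cast hdle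
    _ ≤ _ := hmain

/-! ### The fixed-exponent elimination over the sheet's decls -/

/-- Integer core at a FIXED abc exponent `1 + ε`, `0 < ε < 1/5`: for `x = c₄`, `y = c₆`, `D = Δ ≠ 0`
with `x³ − y² = 1728 D` and `N ≥ 1` satisfying the conductor constraints `H1`, `H2` and the minimality
constraints `H3`–`H5` of `SzpiroOfAbc.natAbs_le_of_abcLe`, `|D| ≤ C · N^{6(1+ε)/(1−5ε)}` with `C > 0`.
(Copy of the tree's `natAbs_le_of_abcLe` with the envelope step removed.) [cite: SilvermanAEC2009,
VIII.11.5(b) and Ex. 8.21] -/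
theorem natAbs_le_of_polyAbcWith {ε : ℝ} (hε : 0 < ε) (hε' : ε < 1 / 5)
    (habc : PolyAbcWith (1 + ε)) :
    ∃ C : ℝ, 0 < C ∧ ∀ (x y D : ℤ) (N : ℕ), D ≠ 0 → N ≠ 0 → x ^ 3 - y ^ 2 = 1728 * D →
      (∀ p : ℕ, p.Prime → (p : ℤ) ∣ D → p ∣ N) →
      (∀ p : ℕ, p.Prime → 5 ≤ p → (p : ℤ) ∣ D → (p : ℤ) ∣ x → p ^ 2 ∣ N) →
      (∀ p : ℕ, p.Prime → 5 ≤ p → (p : ℤ) ^ 4 ∣ x → ¬ (p : ℤ) ^ 6 ∣ y) →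
      ((2 : ℤ) ^ 8 ∣ x → ¬ (2 : ℤ) ^ 11 ∣ y) → ((3 : ℤ) ^ 5 ∣ x → ¬ (3 : ℤ) ^ 9 ∣ y) →
      (D.natAbs : ℝ) ≤ C * (N : ℝ) ^ (6 * (1 + ε) / (1 - 5 * ε)) := by
  obtain ⟨K, hK⟩ := habc
  have hKpos : 0 < K := abc_const_pos hK
  set A : ℝ := (432 * (6 : ℝ) ^ ε * K) ^ (6 / (1 - 5 * ε)) with hA
  have hApos : 0 < A := by positivity
  refine ⟨A + 2 ^ 21 * 3 ^ 16, by positivity, ?_⟩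
  intro x y D N hD hN hrel H1 H2 H3 H4 H5
  have hN1 : (1 : ℝ) ≤ N := by exact_mod_cast Nat.one_le_iff_ne_zero.mpr hN
  have hexp5 : (5 : ℝ) ≤ 6 * (1 + ε) / (1 - 5 * ε) := by
    rw [le_div_iff₀ (by linarith)]; nlinarith
  have hNpow2 : ((N ^ 5 : ℕ) : ℝ) ≤ (N : ℝ) ^ (6 * (1 + ε) / (1 - 5 * ε)) := by
    have : ((N ^ 5 : ℕ) : ℝ) = (N : ℝ) ^ ((5 : ℕ) : ℝ) := by
      rw [Real.rpow_natCast]; push_cast; ring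
    rw [this]
    exact Real.rpow_le_rpow_of_exponent_le hN1 (by exact_mod_cast hexp5)
  have hNpow0 : 0 ≤ (N : ℝ) ^ (6 * (1 + ε) / (1 - 5 * ε)) := by positivity
  -- pass to natural numbers
  have hrel' := natAbs_rel hrel
  set m := x.natAbs with hm
  set n := y.natAbs with hn
  set d := D.natAbs with hd
  have hd0 : d ≠ 0 := Int.natAbs_ne_zero.mpr hD
  have H1' : ∀ p : ℕ, p.Prime → p ∣ d → p ∣ N := fun p hp h ↦ H1 p hp (Int.natCast_dvd.mpr h)
  have H2' : ∀ p : ℕ, p.Prime → 5 ≤ p → p ∣ d → p ∣ m → p ^ 2 ∣ N :=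
    fun p hp h5 h h' ↦ H2 p hp h5 (Int.natCast_dvd.mpr h) (Int.natCast_dvd.mpr h')
  have hpow : ∀ (p k : ℕ) (z : ℤ), (p : ℤ) ^ k ∣ z ↔ p ^ k ∣ z.natAbs := fun p k z ↦ by
    rw [← Int.natCast_dvd]; push_cast; rfl
  have H3' : ∀ p : ℕ, p.Prime → 5 ≤ p → p ^ 4 ∣ m → ¬ p ^ 6 ∣ n := fun p hp h5 h h' ↦
    H3 p hp h5 ((hpow p 4 x).mpr h) ((hpow p 6 y).mpr h')
  have H4' : 2 ^ 8 ∣ m → ¬ 2 ^ 11 ∣ n := fun h h' ↦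
    H4 ((hpow 2 8 x).mpr h) ((hpow 2 11 y).mpr h')
  have H5' : 3 ^ 5 ∣ m → ¬ 3 ^ 9 ∣ n := fun h h' ↦
    H5 ((hpow 3 5 x).mpr h) ((hpow 3 9 y).mpr h')
  -- three cases
  rcases eq_or_ne m 0 with hm0 | hm0
  · -- `c₄ = 0`
    have hrel0 : n ^ 2 = 1728 * d := by
      rw [hm0] at hrel'
      rcases hrel' with h | h | h <;> omega
    have h := core_m_zero hd0 hN hrel0 (fun p hp h5 hpd ↦ H2' p hp h5 hpd (hm0 ▸ dvd_zero p))
      (fun p hp h5 ↦ H3' p hp h5 (hm0 ▸ dvd_zero _)) (H4' (hm0 ▸ dvd_zero _))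
      (H5' (hm0 ▸ dvd_zero _))
    have h' : (d : ℝ) ≤ 2 ^ 20 * 3 ^ 16 * ((N ^ 5 : ℕ) : ℝ) := by exact_mod_cast h
    calc (d : ℝ) ≤ 2 ^ 20 * 3 ^ 16 * ((N ^ 5 : ℕ) : ℝ) := h'
      _ ≤ 2 ^ 21 * 3 ^ 16 * (N : ℝ) ^ (6 * (1 + ε) / (1 - 5 * ε)) := by nlinarith
      _ ≤ (A + 2 ^ 21 * 3 ^ 16) * (N : ℝ) ^ (6 * (1 + ε) / (1 - 5 * ε)) := by nlinarith
  rcases eq_or_ne n 0 with hn0 | hn0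
  · -- `c₆ = 0`
    have hrel0 : m ^ 3 = 1728 * d := by
      rw [hn0] at hrel'
      rcases hrel' with h | h | h <;> omega
    have h := core_n_zero hd0 hN hrel0 H2'
      (fun p hp h5 h4 ↦ H3' p hp h5 h4 (hn0 ▸ dvd_zero _)) (fun h ↦ H4' h (hn0 ▸ dvd_zero _))
      (fun h ↦ H5' h (hn0 ▸ dvd_zero _))
    have h' : (d : ℝ) ≤ 2 ^ 21 * 3 ^ 12 * ((N ^ 5 : ℕ) : ℝ) := by exact_mod_cast h
    calc (d : ℝ) ≤ 2 ^ 21 * 3 ^ 12 * ((N ^ 5 : ℕ) : ℝ) := h'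
      _ ≤ 2 ^ 21 * 3 ^ 16 * (N : ℝ) ^ (6 * (1 + ε) / (1 - 5 * ε)) := by nlinarith
      _ ≤ (A + 2 ^ 21 * 3 ^ 16) * (N : ℝ) ^ (6 * (1 + ε) / (1 - 5 * ε)) := by nlinarith
  · -- main case
    have h := core_main' hε hε' hK hm0 hn0 hd0 hN hrel' H1' H2' H3' H4' H5'
    calc (d : ℝ) ≤ A * (N : ℝ) ^ (6 * (1 + ε) / (1 - 5 * ε)) := h
      _ ≤ (A + 2 ^ 21 * 3 ^ 16) * (N : ℝ) ^ (6 * (1 + ε) / (1 - 5 * ε)) := by nlinarith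

/-- **Fixed-exponent elimination** (Oesterlé–Silverman, `c₄³ = c₆² + 1728Δ`): `POLY-ABC(1+ε) ⟹
POLY-SZPIRO(6(1+ε)/(1−5ε))` for `0 < ε < 1/5`, over the tree decls. The exponent tends to `∞` as the
abc exponent tends to `6/5` (the window closes exactly there).
«NOT abc — POLY-SZPIRO(E)» with `E = 6(1+ε)/(1−5ε)`. [cite: SilvermanAEC2009, VIII.11.5(b) and Ex. 8.21] -/
theorem polySzpiroWith_of_polyAbcWith {ε : ℝ} (hε : 0 < ε) (hε' : ε < 1 / 5)
    (habc : PolyAbcWith (1 + ε)) : PolySzpiroWith (6 * (1 + ε) / (1 - 5 * ε)) := by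
  obtain ⟨C₀, hC₀pos, hC₀⟩ := natAbs_le_of_polyAbcWith hε hε' habc
  set κ : ℝ := 6 * (1 + ε) / (1 - 5 * ε) with hκ
  have hκ0 : 0 ≤ κ := by
    rw [hκ]; exact div_nonneg (by linarith) (by linarith)
  refine ⟨max (Real.log C₀) 0, fun W _ ↦ ?_⟩
  obtain ⟨C, W₀, hCW, hmin⟩ := exists_baseChange_int_forall_isMinimalAt W
  -- `Δ(W₀) ≠ 0`
  have hΔ0 : W₀.Δ ≠ 0 := by
    intro h0
    have h1 : (C • W).Δ = 0 := by simp [hCW, baseChange, map_Δ, h0]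
    exact (C • W).isUnit_Δ.ne_zero h1
  -- `N_E` and `|Δ_min|` computed on `W₀`
  have hN : W.conductorNorm ℤ = (W₀.baseChange ℚ).conductorNorm ℤ := by
    rw [← hCW, conductorNorm_smul_rat]
  have hD : W.minimalDiscriminantNorm ℤ = W₀.Δ.natAbs := by
    rw [← minimalDiscriminantNorm_smul_rat W C, hCW,
      minimalDiscriminantNorm_eq_natAbs_holds W₀ hΔ0 hmin]
  haveI := isElliptic_baseChange_int W₀ hΔ0
  have hNpos : 0 < (W₀.baseChange ℚ).conductorNorm ℤ := conductorNorm_pos_holds (W₀.baseChange ℚ)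
  have hNne : (W₀.baseChange ℚ).conductorNorm ℤ ≠ 0 := hNpos.ne'
  -- the places above `p`, `2`, `3`
  have hplace : ∀ (p : ℕ) (hp : p.Prime), ∃ v : HeightOneSpectrum ℤ,
      Rat.HeightOneSpectrum.natGenerator v = p :=
    fun p hp ↦ ⟨_, natGenerator_primesEquiv_symm p hp⟩
  have key := hC₀ W₀.c₄ W₀.c₆ W₀.Δ ((W₀.baseChange ℚ).conductorNorm ℤ) hΔ0 hNne
    (by linear_combination (-1 : ℤ) * W₀.c_relation)
    (fun p hp hpΔ ↦ dvd_conductorNorm_of_dvd_Δ W₀ hΔ0 hmin hp hpΔ)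
    (fun p hp _ hpΔ hpc ↦ sq_dvd_conductorNorm_of_dvd_Δ_of_dvd_c₄ W₀ hΔ0 hmin hp hpΔ hpc)
    (fun p hp h5 h4 h6 ↦ by
      obtain ⟨v, hv⟩ := hplace p hp
      exact not_pow_dvd_c₄_c₆_of_isMinimalAt v W₀ hΔ0 (hmin v) (hv ▸ h5)
        ⟨hv ▸ h4, hv ▸ h6⟩)
    (fun h4 h6 ↦ by
      obtain ⟨v, hv⟩ := hplace 2 Nat.prime_two
      exact not_pow_dvd_c₄_c₆_of_isMinimalAt_two v W₀ hΔ0 (hmin v) hv ⟨h4, h6⟩)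
    (fun h4 h6 ↦ by
      obtain ⟨v, hv⟩ := hplace 3 Nat.prime_three
      exact not_pow_dvd_c₄_c₆_of_isMinimalAt_three v W₀ hΔ0 (hmin v) hv ⟨h4, h6⟩)
  rw [hD, hN]
  -- take logarithms
  set Nn : ℕ := (W₀.baseChange ℚ).conductorNorm ℤ with hNn
  have hN1 : (1 : ℝ) ≤ (Nn : ℝ) := by exact_mod_cast hNpos
  have hlogN : 0 ≤ Real.log (Nn : ℝ) := Real.log_nonneg hN1
  rcases Nat.eq_zero_or_pos W₀.Δ.natAbs with h0 | hpos
  · rw [h0]; push_cast; rw [Real.log_zero]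
    nlinarith [le_max_right (Real.log C₀) 0]
  · have hdpos : (0 : ℝ) < (W₀.Δ.natAbs : ℝ) := by exact_mod_cast hpos
    have hrhs : 0 < C₀ * (Nn : ℝ) ^ κ := by positivity
    calc Real.log (W₀.Δ.natAbs : ℝ) ≤ Real.log (C₀ * (Nn : ℝ) ^ κ) :=
          Real.log_le_log hdpos key
      _ = Real.log C₀ + κ * Real.log (Nn : ℝ) := by
          rw [Real.log_mul hC₀pos.ne' (by positivity), Real.log_rpow (by positivity)]
      _ ≤ κ * Real.log (Nn : ℝ) + max (Real.log C₀) 0 := by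
          linarith [le_max_left (Real.log C₀) 0]

/-- The same in the exponent-`M` normal form used by the cell: `POLY-ABC(M) ⟹ POLY-SZPIRO(6M/(6−5M))`
for the whole window `1 < M < 6/5` (e.g. `M = 19/16` from lens-5's `e = 19` rung gives `E = 114`). [cite: SilvermanAEC2009,
VIII.11.5(b) and Ex. 8.21] -/
theorem polySzpiroWith_of_polyAbcWith' {M : ℝ} (hM : 1 < M) (hM' : M < 6 / 5)
    (habc : PolyAbcWith M) : PolySzpiroWith (6 * M / (6 - 5 * M)) := by
  have h := polySzpiroWith_of_polyAbcWith (ε := M - 1) (by linarith) (by linarith)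
    (by simpa using habc)
  have e1 : 6 * (1 + (M - 1)) / (1 - 5 * (M - 1)) = 6 * M / (6 - 5 * M) := by ring_nf
  rw [e1] at h
  exact h

/-- **BMY / Nevanlinna rungs reach A-PS below `6/5`**: `ABCWithExponent Λ` (the consequence of
`ParshinHeightConsequence Λ` and of lens-5's `VojtaFermat e (e³)` ladder with `Λ = e/(e−3)`) with
`1 ≤ Λ < 6/5` gives `POLY-SZPIRO(E)` for every `E > 6Λ/(6−5Λ)` — by choosing the abc exponent
`M = 6E/(6+5E) ∈ (Λ, 6/5)`, for which `6M/(6−5M) = E` exactly. Example: `e = 19`, `Λ = 19/16`,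
`E > 114`. «NOT abc — POLY-SZPIRO(E)». [folklore] -/
theorem polySzpiroWith_of_abcWithExponent {Λ E : ℝ} (hΛ1 : 1 ≤ Λ) (hΛ : Λ < 6 / 5)
    (hE : 6 * Λ / (6 - 5 * Λ) < E) (h : GenEll.ABCWithExponent Λ) : PolySzpiroWith E := by
  have hden : 0 < 6 - 5 * Λ := by linarith
  have hE0 : 0 < E := lt_of_le_of_lt (div_nonneg (by linarith) hden.le) hE
  have hE' : 6 * Λ < E * (6 - 5 * Λ) := (div_lt_iff₀ hden).mp hE
  set M : ℝ := 6 * E / (6 + 5 * E) with hMdef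
  have hden' : 0 < 6 + 5 * E := by linarith
  have hΛM : Λ < M := by
    rw [hMdef, lt_div_iff₀ hden']; nlinarith
  have hM65 : M < 6 / 5 := by
    rw [hMdef, div_lt_div_iff₀ hden' (by norm_num)]; nlinarith
  have hM1 : 1 < M := lt_of_le_of_lt hΛ1 hΛM
  have hP : PolyAbcWith M := polyAbcWith_of_abcWithExponent (by linarith) h hΛM
  have key := polySzpiroWith_of_polyAbcWith' hM1 hM65 hP
  have hexp : 6 * M / (6 - 5 * M) = E := by
    have h1 : 6 - 5 * M = 36 / (6 + 5 * E) := by rw [hMdef]; field_simp; ring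
    rw [h1, hMdef, div_div_eq_mul_div]
    field_simp
    ring
  rw [hexp] at key
  exact key

end Summit.ABC.FunctionField
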